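import Summits.BirchSwinnertonDyer.BirchSwinnertonDyer.Theorems.Rank2Observatory2DescClSplitImageClass
import HarnessLib

/-!
# BirchSwinnertonDyer — rank ≥ 2 observatory: KERNEL-2DESC-CL — SPLIT LOCAL IMAGE AT 2: the square-class interface and its bridges (M3c part 1)

HONEST FRAMING: per-curve certified theorems and census instruments; no claim on BSD in rank ≥ 2.

The 2-adic twin of `…SplitImageClass`.  A SQUARE-CLASS MAP AT 2 is an explicit structure `SqClassMapTwo`:
`cls : ℚ_2 → Bool × (Bool × Bool)` (three bits `(v mod 2, χ₋₁(u), χ₂(u))` of `z = 2^v u`), multiplicative on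
non-zero elements, with GRADED local constancy on a coset `a + 2^M ℤ_2` (`a ∈ ℤ ∖ 0`, `v = v_2(a)`): the parity
bit is read off `a` when `v < M`, the bit `χ₋₁` (`u ≡ 3 mod 4`) when `v + 2 ≤ M`, the bit `χ₂` (`u ≡ 3, 5 mod 8`)
when `v + 3 ≤ M`.  Exactness is not part of the interface (not needed by the rank bound); M1 constructs a term.
THIS FILE: the interface, the finite bit algebra of the 9-bit masks of `…SplitImageTree` (`mkTwo`, `sqOkTwo`,
`candTwo`'s candidate lists), the integer lemmas on the 2-adic tree data (terminal separation at `J = D + 4`) and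
the classes of determined roots.  Part 2 (`…SplitImageSoundTwo`) proves `vecTwo_mem_splitImgTwo`.

Sorry-free; axioms `propext`, `Classical.choice`, `Quot.sound`.
[cite: Cassels1991LecturesEllipticCurves, §15]
-/

set_option linter.dupNamespace false
set_option autoImplicit false

namespace Summit.BirchSwinnertonDyer.BirchSwinnertonDyer.Rank2Observatory.TwoDescCl.SplitImage

/-! ## §0 The interface at 2 -/

/-- A SQUARE-CLASS MAP at `2`: `cls z = (v_2(z) mod 2, [u ≡ 3 (4)], [u ≡ 3, 5 (8)])` for `z = 2^v u`,
multiplicative on `ℚ_2^×` (componentwise XOR), with graded local constancy on cosets `a + 2^M ℤ_2`.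
An explicit structure (no instance); constructed in `…PadicSquareClass` (M1).
[cite: Cassels1991LecturesEllipticCurves, §15] -/
structure SqClassMapTwo where
  /-- the class of `z` as three bits `(v mod 2, χ₋₁, χ₂)` (value on `0` irrelevant) -/
  cls : ℚ_[2] → Bool × (Bool × Bool)
  /-- multiplicativity on non-zero elements -/
  cls_mul : ∀ z w : ℚ_[2], z ≠ 0 → w ≠ 0 →
    cls (z * w) = ((cls z).1 != (cls w).1, ((cls z).2.1 != (cls w).2.1, (cls z).2.2 != (cls w).2.2))
  /-- the parity of the valuation of `a + 2^M t` is that of `a` when `v_2(a) < M` -/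
  cls_val : ∀ (z : ℚ_[2]) (a : ℤ) (M : ℕ) (t : ℤ_[2]), a ≠ 0 → padicValInt 2 a < M →
    z = (a : ℚ_[2]) + (2 : ℚ_[2]) ^ M * (t : ℚ_[2]) → (cls z).1 = decide (padicValInt 2 a % 2 = 1)
  /-- the unit part of `a + 2^M t` is that of `a` modulo `4` when `v_2(a) + 2 ≤ M` -/
  cls_chi4 : ∀ (z : ℚ_[2]) (a : ℤ) (M : ℕ) (t : ℤ_[2]), a ≠ 0 → padicValInt 2 a + 2 ≤ M →
    z = (a : ℚ_[2]) + (2 : ℚ_[2]) ^ M * (t : ℚ_[2]) →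
    (cls z).2.1 = decide (a / (2 : ℤ) ^ padicValInt 2 a % 4 = 3)
  /-- the unit part of `a + 2^M t` is that of `a` modulo `8` when `v_2(a) + 3 ≤ M` -/
  cls_chi8 : ∀ (z : ℚ_[2]) (a : ℤ) (M : ℕ) (t : ℤ_[2]), a ≠ 0 → padicValInt 2 a + 3 ≤ M →
    z = (a : ℚ_[2]) + (2 : ℚ_[2]) ^ M * (t : ℚ_[2]) →
    (cls z).2.2 = decide (a / (2 : ℤ) ^ padicValInt 2 a % 8 = 3 ∨ a / (2 : ℤ) ^ padicValInt 2 a % 8 = 5)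

/-- The 9-bit vector of three classes at `2`. [folklore] -/
def vec3Two (c₀ c₁ c₂ : Bool × (Bool × Bool)) : ℕ := mkTwo 0 c₀.1 c₀.2 + mkTwo 1 c₁.1 c₁.2 + mkTwo 2 c₂.1 c₂.2

/-- The class vector of a point with abscissa `x` at `2`: `(cls (x − e_i))_i` as a 9-bit mask.
[cite: Cassels1991LecturesEllipticCurves, §15] -/
noncomputable def vecTwo (S : SqClassMapTwo) (x : ℚ_[2]) (e : Fin 3 → ℤ_[2]) : ℕ :=
  vec3Two (S.cls (x - (e 0 : ℚ_[2]))) (S.cls (x - (e 1 : ℚ_[2]))) (S.cls (x - (e 2 : ℚ_[2])))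

/-! ## §1 Bit algebra at 2 (finite checks) -/

/-- On a class vector, `sqOkTwo` tests that the componentwise XOR of the three classes vanishes. [folklore] -/
theorem sqOkTwo_vec3Two (c₀ c₁ c₂ : Bool × (Bool × Bool)) :
    sqOkTwo (vec3Two c₀ c₁ c₂) =
      ((((c₀.1 != c₁.1) != c₂.1) == false) && ((((c₀.2.1 != c₁.2.1) != c₂.2.1) == false) &&
        (((c₀.2.2 != c₁.2.2) != c₂.2.2) == false))) := by
  obtain ⟨a0, b0, d0⟩ := c₀; obtain ⟨a1, b1, d1⟩ := c₁; obtain ⟨a2, b2, d2⟩ := c₂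
  cases a0 <;> cases b0 <;> cases d0 <;> cases a1 <;> cases b1 <;> cases d1 <;> cases a2 <;> cases b2 <;>
    cases d2 <;> decide

/-- Three trivial classes give the zero mask. [folklore] -/
theorem vec3Two_false : vec3Two (false, (false, false)) (false, (false, false)) (false, (false, false)) = 0 := by
  decide

/-- Every class is a candidate on an undetermined coset (`candTwo`, first case). [folklore] -/
theorem mem_candTwo_all (c : Bool × (Bool × Bool)) :
    c ∈ (unitClasses.map fun u => (false, u)) ++ (unitClasses.map fun u => (true, u)) := by
  obtain ⟨a, b, d⟩ := c; cases a <;> cases b <;> cases d <;> decide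

/-- Every unit class is a candidate when only the parity is determined (`candTwo`, second case). [folklore] -/
theorem mem_candTwo_parity (b : Bool) (u : Bool × Bool) : (b, u) ∈ unitClasses.map fun c => (b, c) := by
  obtain ⟨u1, u2⟩ := u; cases b <;> cases u1 <;> cases u2 <;> decide

/-- When the unit part is known modulo `4` (odd residue `u`), the class is one of the two listed by `candTwo`
(third case). [folklore] -/
theorem mem_candTwo_pair (b c8 : Bool) {u : ℤ} (hu : u % 4 = 1 ∨ u % 4 = 3) :
    (b, (decide (u % 4 = 3), c8)) ∈ [(b, chiBits (u % 4)), (b, chiBits (u % 4 + 4))] := by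
  rcases hu with h | h <;> rw [h] <;> cases b <;> cases c8 <;> decide

/-- `chiBits` only depends on the residue modulo `8`. [folklore] -/
theorem chiBits_congr {u u' : ℤ} (h : u % 8 = u' % 8) : chiBits u = chiBits u' := by
  have h4 : u % 4 = u' % 4 := by omega
  unfold chiBits
  rw [h4, h]

/-! ## §2 Integer lemmas on the 2-adic tree data -/

/-- Unfolding of the leaf predicate at `2`: `r − ē_i ≠ 0` and `v_2(r − ē_i) + 3 ≤ j`. [folklore] -/
theorem leafTwo_eq_true_iff (e : Fin 3 → ℤ) (j : ℕ) (r : ℤ) (i : Fin 3) :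
    leafTwo e j r i = true ↔ r - e i ≠ 0 ∧ valInt 2 (r - e i) + 3 ≤ j := by
  simp [leafTwo]

/-- A non-leaf root at level `j` has `2^{j−2} ∣ r − ē_i`. [folklore] -/
theorem pow_dvd_of_leafTwo_false {e : Fin 3 → ℤ} {j : ℕ} {r : ℤ} {i : Fin 3}
    (h : leafTwo e j r i = false) : (2 : ℤ) ^ (j - 2) ∣ r - e i := by
  have key : ((2 : ℕ) : ℤ) ^ (j - 2) ∣ r - e i ↔ r - e i = 0 ∨ j - 2 ≤ valInt 2 (r - e i) :=
    pow_dvd_iff_valInt (j - 2) (r - e i)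
  rw [Nat.cast_ofNat] at key
  rw [key]
  by_contra hc
  simp only [not_or, not_le] at hc
  have : leafTwo e j r i = true := (leafTwo_eq_true_iff e j r i).mpr ⟨hc.1, by omega⟩
  rw [h] at this; exact Bool.false_ne_true this

/-- **Terminal separation at 2**: at level `J = D + 4` two distinct roots cannot both be undetermined. [folklore] -/
theorem leafTwo_of_leafTwo_false {e : Fin 3 → ℤ} {J : ℕ} (hJ : J = nodeDepth 2 e + 4) {r : ℤ}
    {i k : Fin 3} (hik : i ≠ k) (hē : e i ≠ e k) (hi : leafTwo e J r i = false) :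
    leafTwo e J r k = true := by
  by_contra hk
  rw [Bool.not_eq_true] at hk
  have h1 := pow_dvd_of_leafTwo_false hi
  have h2 := pow_dvd_of_leafTwo_false hk
  have h3 : (2 : ℤ) ^ (J - 2) ∣ e i - e k := by
    have := dvd_sub h2 h1
    simpa using this
  have key : ((2 : ℕ) : ℤ) ^ (J - 2) ∣ e i - e k ↔ e i - e k = 0 ∨ J - 2 ≤ valInt 2 (e i - e k) :=
    pow_dvd_iff_valInt (J - 2) (e i - e k)
  rw [Nat.cast_ofNat] at key
  rcases key.mp h3 with h0 | hle
  · exact hē (sub_eq_zero.mp h0)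
  · have := valInt_sub_le_nodeDepth (ℓ := 2) e i k hik
    omega

/-- When not all three indices are leaves, `matchTwo` returns a non-leaf index. [folklore] -/
theorem leafTwo_matchTwo {e : Fin 3 → ℤ} {j : ℕ} {r : ℤ}
    (h : ¬ (leafTwo e j r 0 && leafTwo e j r 1 && leafTwo e j r 2) = true) :
    leafTwo e j r (matchTwo e j r) = false := by
  unfold matchTwo
  revert h
  cases h0 : leafTwo e j r 0 <;> cases h1 : leafTwo e j r 1 <;> cases h2 : leafTwo e j r 2 <;>
    simp [h0, h1, h2]

/-- A node at `2` defers its residue (`none`) only strictly above the terminal level. [folklore] -/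
theorem nodeTwo_eq_none {J : ℕ} {e : Fin 3 → ℤ} {j : ℕ} {r : ℤ} (h : nodeTwo J e j r = none) : j < J := by
  unfold nodeTwo at h
  split_ifs at h with h1 h2
  exact h2

/-- The bits of the two other roots plus the matching root's class give the full 9-bit vector. [folklore] -/
theorem baseTwo_add_mkTwo (e : Fin 3 → ℤ) (r : ℤ) (i : Fin 3) (c : Fin 3 → Bool × (Bool × Bool))
    (h : ∀ k : Fin 3, k ≠ i → bitsTwo k.val (r - e k) = mkTwo k.val (c k).1 (c k).2) :
    baseTwo e r i + mkTwo i.val (c i).1 (c i).2 = vec3Two (c 0) (c 1) (c 2) := by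
  fin_cases i
  · have h1 := h 1 (by decide); have h2 := h 2 (by decide)
    simp only [Fin.val_one, Fin.val_two] at h1 h2
    simp only [baseTwo, Fin.zero_eta, Fin.isValue, ↓reduceIte, h1, h2, vec3Two]; omega
  · have h0 := h 0 (by decide); have h2 := h 2 (by decide)
    simp only [Fin.val_zero, Fin.val_two] at h0 h2
    simp only [baseTwo, Fin.mk_one, Fin.isValue, one_ne_zero, ↓reduceIte, h0, h2, vec3Two]; omega
  · have h0 := h 0 (by decide); have h1 := h 1 (by decide)
    simp only [Fin.val_zero, Fin.val_one] at h0 h1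
    simp only [baseTwo, Fin.reduceFinMk, Fin.isValue, Fin.reduceEq, ↓reduceIte, h0, h1, vec3Two]

/-- If each `bitsTwo` summand is the mask of a class `c k`, the node's bit vector is `vec3Two (c 0) (c 1) (c 2)`.
[folklore] -/
theorem bvTwo_eq_vec3Two (e : Fin 3 → ℤ) (r : ℤ) (c : Fin 3 → Bool × (Bool × Bool))
    (h : ∀ k : Fin 3, bitsTwo k.val (r - e k) = mkTwo k.val (c k).1 (c k).2) :
    bvTwo e r = vec3Two (c 0) (c 1) (c 2) := by
  have h0 := h 0; have h1 := h 1; have h2 := h 2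
  simp only [Fin.val_zero, Fin.val_one, Fin.val_two] at h0 h1 h2
  simp only [bvTwo, h0, h1, h2, vec3Two]

/-- An odd integer has `valInt 2 = 0` and is its own unit part. [folklore] -/
theorem unitPart_of_odd {a : ℤ} (ha : ¬ (2 : ℤ) ∣ a) : valInt 2 a = 0 ∧ unitPart 2 a = a := by
  have ha0 : a ≠ 0 := by rintro rfl; exact ha (dvd_zero 2)
  have hv : valInt 2 a = 0 := by
    rw [valInt_eq ha0]; exact padicValInt.eq_zero_of_not_dvd ha
  refine ⟨hv, ?_⟩
  rw [unitPart, hv, pow_zero, Int.ediv_one]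

/-- The unit part of a non-zero integer at `2` is odd: residue `1` or `3` modulo `4`. [folklore] -/
theorem unitPart_two_mod_four {d : ℤ} (hd : d ≠ 0) : unitPart 2 d % 4 = 1 ∨ unitPart 2 d % 4 = 3 := by
  have h := not_dvd_div_pow_padicValInt (ℓ := 2) hd
  rw [Nat.cast_ofNat] at h
  have h' : ¬ (2 : ℤ) ∣ unitPart 2 d := by
    rw [unitPart, valInt_eq hd]; exact_mod_cast h
  rw [Int.two_dvd_ne_zero] at h'
  omega

/-! ## §3 2-adic lemmas: the square condition and the classes of determined roots -/

/-- The square condition at `2`: if `y² = z₀ z₁ z₂`, `y ≠ 0`, the three classes XOR to zero (three bits).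
[cite: Cassels1991LecturesEllipticCurves, §15] -/
theorem xor3_of_sq_two (S : SqClassMapTwo) {y z₀ z₁ z₂ : ℚ_[2]} (hy : y ≠ 0) (h : y ^ 2 = z₀ * z₁ * z₂) :
    (((S.cls z₀).1 != (S.cls z₁).1) != (S.cls z₂).1) = false ∧
      (((S.cls z₀).2.1 != (S.cls z₁).2.1) != (S.cls z₂).2.1) = false ∧
      (((S.cls z₀).2.2 != (S.cls z₁).2.2) != (S.cls z₂).2.2) = false := by
  have hz : z₀ * z₁ * z₂ ≠ 0 := h ▸ pow_ne_zero 2 hy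
  have hz2 : z₂ ≠ 0 := right_ne_zero_of_mul hz
  have hz01 : z₀ * z₁ ≠ 0 := left_ne_zero_of_mul hz
  have hz0 : z₀ ≠ 0 := left_ne_zero_of_mul hz01
  have hz1 : z₁ ≠ 0 := right_ne_zero_of_mul hz01
  have e1 := S.cls_mul y y hy hy
  rw [← pow_two, h, S.cls_mul _ _ hz01 hz2, S.cls_mul _ _ hz0 hz1] at e1
  simp only [bne_self_eq_false, Prod.mk.injEq] at e1
  exact e1

/-- The square condition on the class vector: `sqOkTwo (vecTwo S x e)`. [cite: Cassels1991LecturesEllipticCurves, §15] -/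
theorem sqOkTwo_vecTwo (S : SqClassMapTwo) {x y : ℚ_[2]} {e : Fin 3 → ℤ_[2]} (hy : y ≠ 0)
    (hcurve : y ^ 2 = (x - e 0) * (x - e 1) * (x - e 2)) : sqOkTwo (vecTwo S x e) = true := by
  have hsq := xor3_of_sq_two S hy hcurve
  unfold vecTwo; rw [sqOkTwo_vec3Two]; simp [hsq.1, hsq.2.1, hsq.2.2]

/-- The class of a square is trivial. [folklore] -/
theorem cls_mul_self (S : SqClassMapTwo) {w : ℚ_[2]} (hw : w ≠ 0) : S.cls (w * w) = (false, (false, false)) := by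
  rw [S.cls_mul w w hw hw]; simp

/-- **Parity of a root determined to order `v < j`**. [cite: Cassels1991LecturesEllipticCurves, §15] -/
theorem cls_val_of_approx (S : SqClassMapTwo) {z : ℚ_[2]} {w : ℤ} {j : ℕ} (T : ℤ_[2]) (hw : w ≠ 0)
    (hv : valInt 2 w < j) (hz : z = (w : ℚ_[2]) + (2 : ℚ_[2]) ^ j * (T : ℚ_[2])) :
    (S.cls z).1 = decide (valInt 2 w % 2 = 1) := by
  rw [S.cls_val z w j T hw (by rw [← valInt_eq hw]; exact hv) hz, valInt_eq hw]

/-- **`χ₋₁` of a root determined to order `v + 2 ≤ j`**. [cite: Cassels1991LecturesEllipticCurves, §15] -/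
theorem cls_chi4_of_approx (S : SqClassMapTwo) {z : ℚ_[2]} {w : ℤ} {j : ℕ} (T : ℤ_[2]) (hw : w ≠ 0)
    (hv : valInt 2 w + 2 ≤ j) (hz : z = (w : ℚ_[2]) + (2 : ℚ_[2]) ^ j * (T : ℚ_[2])) :
    (S.cls z).2.1 = decide (unitPart 2 w % 4 = 3) := by
  rw [S.cls_chi4 z w j T hw (by rw [← valInt_eq hw]; exact hv) hz, unitPart, valInt_eq hw, Nat.cast_ofNat]

/-- **Class of a root determined to order `v + 3 ≤ j`**: `cls z` is M3a's `bitsTwo` data of `w`.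
[cite: Cassels1991LecturesEllipticCurves, §15] -/
theorem cls_eq_of_approx_two (S : SqClassMapTwo) {z : ℚ_[2]} {w : ℤ} {j : ℕ} (T : ℤ_[2]) (hw : w ≠ 0)
    (hv : valInt 2 w + 3 ≤ j) (hz : z = (w : ℚ_[2]) + (2 : ℚ_[2]) ^ j * (T : ℚ_[2])) :
    S.cls z = (decide (valInt 2 w % 2 = 1), chiBits (unitPart 2 w)) := by
  have h1 := cls_val_of_approx S T hw (by omega) hz
  have h2 := cls_chi4_of_approx S T hw (by omega) hz
  have h3 := S.cls_chi8 z w j T hw (by rw [← valInt_eq hw]; exact hv) hz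
  rw [← valInt_eq hw] at h3
  have hu : unitPart 2 w = w / (2 : ℤ) ^ valInt 2 w := by rw [unitPart, Nat.cast_ofNat]
  refine Prod.ext h1 (Prod.ext h2 ?_)
  show (S.cls z).2.2 = decide (unitPart 2 w % 8 = 3 ∨ unitPart 2 w % 8 = 5)
  rw [hu]; exact h3

end Summit.BirchSwinnertonDyer.BirchSwinnertonDyer.Rank2Observatory.TwoDescCl.SplitImage
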